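import Literature.GroupTheory.CombinatorialGroupTheory.CyclicBlockInterchangeCl
import Literature.GroupTheory.CombinatorialGroupTheory.CommutatorLengthNPRank
import Literature.Computability.Complexity.TruthTableClosure
import HarnessLib

/-!
# CBI-`A` reduces to CL-`F(A)` in polynomial time (Heuer 2020, Thm. 2 (ii))

[Heuer2020, §1]: "CBI-`A`: given related `v, w ∈ A⁺` and `n ∈ ℕ`, decide whether
`d_cbi(v, w) ≤ n`"; [Heuer2020, Thm. 2 (ii)]: "there is a polynomial time reduction from CBI-`A` to
CL-`F(A)`", proved in §3.3 by `|w|` calls to CL: "in time `|w|` we may decide `cl(v + w⁻¹) ≤ n`,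
using the decision problem CL-`F(A)`" (Claim 3.11). With the query characterisation
`d_cbi(v, w) ≤ k ↔ ∃ i < |v|, cl(v · (σⁱ w)⁻¹) ≤ k` of `CyclicBlockInterchangeCl.lean` this file
builds that reduction as a **polynomial-time truth-table (hence Turing) reduction** in the tree's
oracle framework (`TruthTableClosure.lean`: query generator `Q ∈ FP`, evaluator `D ∈ P`,
`ttLang Q q D A ∈ P^A`):

* the language CBI-`F_r` over `{0,1}` (`cbiDecisionSet`, `cbiInstanceCode`, `cbiLanguage r`:
  instances `((v, w), k)` with `v, w : List (Fin r)`, coded as `⟨⟨code v, code w⟩, 1ᵏ⟩` with the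
  fixed-width letter code of `CommutatorLengthNP.lean`; yes iff `v, w` related and `d_cbi(v,w) ≤ k`);
* the query generator `CBIRed.qFn r ∈ FP`: query `i` is the CL-`F_r` instance code of
  `(v · (σⁱ w)⁻¹, k)` (`qFn_code`);
* the evaluator `CBIRed.dLang r ∈ P`: accept a well-formed instance with `|v| = |w|` iff `v = []` or one
  of the first `|v|` answers is yes (`mem_dLang_iff`) — relatedness need not be tested, because
  `v · w̃⁻¹ ∈ [F, F]` iff `v, w̃` are related (`mk_cword_mem_commutator_iff`), so unrelated instances
  receive only negative answers;
* **`cbiLanguage_eq_ttLang`**, **`cbiLanguage_mem_PRel : cbiLanguage r ∈ P^{CL-F_r}`**, i.e.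
  CBI-`F_r` `≤ᵀₚ` CL-`F_r` ([Heuer2020, Thm. 2 (ii)]);
* the bookkeeping for the named fact: **`Heuer2020_clNPComplete_of_cbi_isNPHard`** — if
  CBI-`F₂` is NP-hard (the binary case of [Heuer2020, Thm. 3], not proved in the tree) then
  `Heuer2020_clNPComplete` holds (`Heuer2020_clNPComplete_iff_two`).

Everything here is proved; no named facts.

## References

* [Heuer2020] N. Heuer, *Computing commutator length is hard*, arXiv:2001.10230, §1 (CBI-`A`),
  §3.3 (Claim 3.11, Thm. 2 (ii)), §5.
* [LadnerLynchSelman1975] R. Ladner, N. Lynch, A. Selman, *A comparison of polynomial time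
  reducibilities*, TCS 1 (1975), §3 (`≤ᵖₜₜ ⇒ ≤ᵖ_T`).
-/

noncomputable section

namespace Literature.GroupTheory.CombinatorialGroupTheory

open _root_.Computability Literature.Computability.Complexity Literature.Computability.Complexity.Brick
  Literature.Computability.Complexity.HashBricks Literature.Computability.Complexity.Plumb
  Literature.Computability.Complexity.OracleCompose Polynomial
open scoped Literature.Computability.Complexity.Notation

/-! ### The decision problem CBI-`F_r` as a language over `{0,1}` -/

/-- Yes-instances of CBI-`F_r` ([Heuer2020, §1]): `((v, w), k)` with `v, w` related positive words
over `Fin r` and `d_cbi(v, w) ≤ k`. [cite: Heuer2020, §1 (Definition CBI-A)] -/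
def cbiDecisionSet (r : ℕ) : Set ((List (Fin r) × List (Fin r)) × ℕ) :=
  {p | List.Perm p.1.1 p.1.2 ∧ CBI.dcbi p.1.1 p.1.2 ≤ p.2}

/-- The string of an instance: `⟨⟨code v, code w⟩, 1ᵏ⟩` (letter code of `CommutatorLengthNP.lean`
on the positive words, `k` in unary). [cite: Heuer2020, §1 (Definition CBI-A)] -/
def cbiInstanceCode (r : ℕ) (p : (List (Fin r) × List (Fin r)) × ℕ) : List Bool :=
  boolPair (boolPair (clWordCode r (CBI.pos p.1.1)) (clWordCode r (CBI.pos p.1.2))) (unaryEncodeNat p.2)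

/-- The language CBI-`F_r ⊆ {0,1}*`. [cite: Heuer2020, §1 (Definition CBI-A)] -/
def cbiLanguage (r : ℕ) : Language Bool :=
  cbiInstanceCode r '' cbiDecisionSet r

/-- `pos` is injective. [folklore] -/
theorem CBI.pos_injective {β : Type*} : Function.Injective (CBI.pos (β := β)) :=
  fun _ _ h => List.map_injective_iff.2 (fun _ _ hab => congrArg Prod.fst hab) h

/-- The instance code is injective. [folklore] -/
theorem cbiInstanceCode_injective (r : ℕ) : Function.Injective (cbiInstanceCode r) := by
  rintro ⟨⟨v, w⟩, k⟩ ⟨⟨v', w'⟩, k'⟩ h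
  have h1 := boolPair_injective (a₁ := (_, _)) (a₂ := (_, _)) h
  simp only [Prod.mk.injEq] at h1
  have h2 := boolPair_injective (a₁ := (_, _)) (a₂ := (_, _)) h1.1
  simp only [Prod.mk.injEq] at h2
  have hv := CBI.pos_injective (clWordCode_injective r h2.1)
  have hw := CBI.pos_injective (clWordCode_injective r h2.2)
  have hk : k = k' := by simpa [unary_decode_encode_nat] using congrArg unaryDecodeNat h1.2
  rw [hv, hw, hk]

/-- Membership of a coded instance. [folklore] -/
@[simp] theorem cbiInstanceCode_mem_cbiLanguage_iff {r : ℕ} (p : (List (Fin r) × List (Fin r)) × ℕ) :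
    cbiInstanceCode r p ∈ cbiLanguage r ↔ p ∈ cbiDecisionSet r :=
  (cbiInstanceCode_injective r).mem_set_image

/-- **The query element lies in `[F, F]` iff the words are related.** [cite: Heuer2020, §3.3] -/
theorem CBI.mk_cword_mem_commutator_iff {β : Type*} [DecidableEq β] (v w : List β) :
    FreeGroup.mk (CBI.cword v w) ∈ commutator (FreeGroup β) ↔ List.Perm v w := by
  refine ⟨fun h => ?_, CBI.mk_cword_mem_commutator⟩
  rw [mk_mem_commutator_iff_count] at h
  rw [List.perm_iff_count]
  intro a
  rw [← CBI.count_cword_true v w a, ← CBI.count_cword_false v w a, h]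

/-- Sanity instance ([Heuer2020, Example 3.1]): `(a b a b a b, a a a b b b, 1)` is a yes-instance of CBI-`F₂`. -/
example : (([0, 1, 0, 1, 0, 1], [0, 0, 0, 1, 1, 1]), 1) ∈ cbiDecisionSet 2 :=
  ⟨by decide, CBI.dcbi_le_one_of_isCBI ⟨[1, 0, 1, 0, 1, 0], [1, 0, 0, 0, 1, 1], ⟨1, rfl⟩, ⟨1, rfl⟩,
    ⟨[1, 0], [1], [0, 1], [0], rfl, rfl⟩⟩⟩

namespace CBIRed

open CLNP

variable (r : ℕ)

/-! ### The query generator -/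

/-- On `z = ⟨x, 1ⁱ⟩`, `x = ⟨⟨cv, cw⟩, 1ᵏ⟩`: the code `cv` of `v`. [folklore] -/
def cvF : List Bool → List Bool := fstF ∘ fstF ∘ fstF
/-- The code `cw` of `w`. [folklore] -/
def cwF : List Bool → List Bool := sndF ∘ fstF ∘ fstF
/-- The unary threshold `1ᵏ`. [folklore] -/
def uF : List Bool → List Bool := sndF ∘ fstF
/-- `1ⁿ`, `n` the number of letters of `w`. [folklore] -/
def nF : List Bool → List Bool := nU r ∘ fanoutFn (cwF) fun _ => []

/-- On `⟨z, 1ʲ⟩`: the unary index `1^{(n − (j+1) + i) mod n}` of the letter of `w` to emit. [folklore] -/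
def mFn : List Bool → List Bool :=
  sndF ∘ divModFn ∘ fanoutFn (nF r ∘ fstF)
    (appF ∘ fanoutFn (dropFn ∘ fanoutFn (List.cons true ∘ sndF) (nF r ∘ fstF)) (sndF ∘ fstF))

/-- On `⟨z, 1ʲ⟩`: the letter block of `w` at that index. [folklore] -/
def blkFn : List Bool → List Bool :=
  blkAt r ∘ fanoutFn (fanoutFn (cwF ∘ fstF) fun _ => []) (mFn r)

/-- On `⟨z, 1ʲ⟩`: that block with its sign bit turned negative. [folklore] -/
def gFn : List Bool → List Bool :=
  appF ∘ fanoutFn (takeFn ∘ fanoutFn (fun _ => ones r) (blkFn r)) fun _ => [false]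

/-- On `z`: the code of `(σⁱ w)⁻¹`, the concatenation of the blocks `gFn ⟨z, 1ʲ⟩`, `j < n`. [folklore] -/
def nrFn : List Bool → List Bool :=
  sndPow 2 ∘ foldLoop appF (gFn r) X ∘ fanoutFn id (fanoutFn (lenBinF ∘ nF r) fun _ => boolPair [] [])

/-- **The query generator**: `qFn ⟨x, 1ⁱ⟩ = ⟨cv ++ code((σⁱ w)⁻¹), 1ᵏ⟩`, the CL-`F_r` instance code of
`(v · (σⁱ w)⁻¹, k)`. [cite: Heuer2020, Claim 3.11] -/
def qFn : List Bool → List Bool := fanoutFn (appF ∘ fanoutFn (cvF) (nrFn r)) uF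

/-- `cvF ∈ FP`. [cite: AroraBarakCC2009, §1.3] -/
theorem cvF_mem_FP : cvF ∈ FP := comp_mem_FP fstF_mem_FP (comp_mem_FP fstF_mem_FP fstF_mem_FP)
/-- `cwF ∈ FP`. [cite: AroraBarakCC2009, §1.3] -/
theorem cwF_mem_FP : cwF ∈ FP := comp_mem_FP sndF_mem_FP (comp_mem_FP fstF_mem_FP fstF_mem_FP)
/-- `uF ∈ FP`. [cite: AroraBarakCC2009, §1.3] -/
theorem uF_mem_FP : uF ∈ FP := comp_mem_FP sndF_mem_FP fstF_mem_FP
/-- `nF ∈ FP`. [cite: AroraBarakCC2009, §1.3] -/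
theorem nF_mem_FP : nF r ∈ FP := comp_mem_FP (nU_mem_FP r) (fanoutFn_mem_FP cwF_mem_FP (const_mem_FP _))
/-- `mFn ∈ FP`. [cite: AroraBarakCC2009, §1.3] -/
theorem mFn_mem_FP : mFn r ∈ FP :=
  comp_mem_FP sndF_mem_FP (comp_mem_FP divModFn_mem_FP (fanoutFn_mem_FP (comp_mem_FP (nF_mem_FP r) fstF_mem_FP)
    (comp_mem_FP appF_mem_FP (fanoutFn_mem_FP
      (comp_mem_FP dropFn_mem_FP (fanoutFn_mem_FP (comp_mem_FP (cons_mem_FP true) sndF_mem_FP)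
        (comp_mem_FP (nF_mem_FP r) fstF_mem_FP)))
      (comp_mem_FP sndF_mem_FP fstF_mem_FP)))))
/-- `blkFn ∈ FP`. [cite: AroraBarakCC2009, §1.3] -/
theorem blkFn_mem_FP : blkFn r ∈ FP :=
  comp_mem_FP (blkAt_mem_FP r) (fanoutFn_mem_FP (fanoutFn_mem_FP (comp_mem_FP cwF_mem_FP fstF_mem_FP) (const_mem_FP _))
    (mFn_mem_FP r))
/-- `gFn ∈ FP`. [cite: AroraBarakCC2009, §1.3] -/
theorem gFn_mem_FP : gFn r ∈ FP :=
  comp_mem_FP appF_mem_FP (fanoutFn_mem_FP (comp_mem_FP takeFn_mem_FP (fanoutFn_mem_FP (const_mem_FP _) (blkFn_mem_FP r)))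
    (const_mem_FP _))

/-- Growth of `gFn`: at most `r + 1` symbols. [folklore] -/
theorem length_gFn_le (z : List Bool) : (gFn r z).length ≤ (r + 1) * ((fstF z).length + 1) := by
  have h1 : (gFn r z).length ≤ r + 1 := by
    simp [gFn, ones]
  exact h1.trans (Nat.le_mul_of_pos_right _ (Nat.succ_pos _))

/-- `nrFn ∈ FP` (a bounded concatenation loop). [cite: AroraBarakCC2009, §1.3 (bounded loops)] -/
theorem nrFn_mem_FP : nrFn r ∈ FP :=
  comp_mem_FP (sndPow_mem_FP 2) (comp_mem_FP
    (foldLoop_mem_FP appF_mem_FP length_appF_le (gFn_mem_FP r) (length_gFn_le r) X)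
    (fanoutFn_mem_FP id_mem_FP (fanoutFn_mem_FP (comp_mem_FP lenBinF_mem_FP (nF_mem_FP r)) (const_mem_FP _))))

/-- **`qFn ∈ FP`.** [cite: AroraBarakCC2009, §1.3] -/
theorem qFn_mem_FP : qFn r ∈ FP :=
  fanoutFn_mem_FP (comp_mem_FP appF_mem_FP (fanoutFn_mem_FP cvF_mem_FP (nrFn_mem_FP r))) uF_mem_FP

/-! ### Values of the query generator on instance codes -/

section Values

variable {r}
variable (v w : List (Fin r)) (k : ℕ)

/-- The records read by the generator (`b = 1ⁱ`) and by the evaluator (`b` = the answer bits). [folklore] -/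
def yCode (b : List Bool) : List Bool := boolPair (cbiInstanceCode r ((v, w), k)) b

/-- A positive word code has `(r+1)·|v|` symbols. [folklore] -/
theorem length_clWordCode_pos : (clWordCode r (CBI.pos v)).length = (r + 1) * v.length := by
  rw [length_clWordCode, CBI.pos, List.length_map]

variable (b : List Bool)

/-- `cvF y = code v`. [folklore] -/
@[simp] theorem cvF_yCode : cvF (yCode v w k b) = clWordCode r (CBI.pos v) := by simp [cvF, yCode, cbiInstanceCode]
/-- `cwF y = code w`. [folklore] -/
@[simp] theorem cwF_yCode : cwF (yCode v w k b) = clWordCode r (CBI.pos w) := by simp [cwF, yCode, cbiInstanceCode]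
/-- `uF y = 1ᵏ`. [folklore] -/
@[simp] theorem uF_yCode : uF (yCode v w k b) = ones k := by
  simp [uF, yCode, cbiInstanceCode, OracleCompose.unaryEncodeNat_eq_replicate]
/-- `sndF y = b`. [folklore] -/
@[simp] theorem sndF_yCode : sndF (yCode v w k b) = b := by simp [yCode]
/-- `nF y = 1ⁿ`, `n = |w|`. [folklore] -/
@[simp] theorem nF_yCode : nF r (yCode v w k b) = ones w.length := by
  rw [nF, Function.comp_apply, fanoutFn_apply, cwF_yCode, nU_apply, fstF_boolPair, length_clWordCode_pos,
    Nat.mul_div_cancel_left _ (Nat.succ_pos r)]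

variable {v w k b}
variable {i : ℕ}

/-- The emitted index: `1^{(n − (j+1) + i) mod n}`. [folklore] -/
theorem mFn_zCode (i j : ℕ) : mFn r (boolPair (yCode v w k (ones i)) (ones j)) = ones ((w.length - 1 - j + i) % w.length) := by
  rw [mFn]
  simp only [Function.comp_apply, fanoutFn_apply, fstF_boolPair, sndF_boolPair, nF_yCode, sndF_yCode, dropFn_boolPair,
    List.length_cons, List.length_replicate, appF_boolPair, List.drop_replicate, List.replicate_append_replicate]
  rw [show w.length - (j + 1) + i = w.length - 1 - j + i by omega, divModFn_boolPair, sndF_boolPair]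

/-- The letter of `w` at a position, in the code. [folklore] -/
theorem take_drop_clWordCode_pos {m : ℕ} (hm : m < w.length) :
    ((clWordCode r (CBI.pos w)).drop (m * (r + 1))).take (r + 1) = clLetterCode r (w[m], true) := by
  rw [take_drop_clWordCode r (CBI.pos w) m (by rw [CBI.pos, List.length_map]; exact hm)]
  simp [CBI.pos]

/-- The emitted block: the letter `w[m]` made negative. [folklore] -/
theorem gFn_zCode {i j : ℕ} (hn : 0 < w.length) :
    gFn r (boolPair (yCode v w k (ones i)) (ones j)) = clLetterCode r (w[(w.length - 1 - j + i) % w.length]'(Nat.mod_lt _ hn), false) := by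
  have hm : (w.length - 1 - j + i) % w.length < w.length := Nat.mod_lt _ hn
  rw [gFn]
  simp only [Function.comp_apply, fanoutFn_apply, appF_boolPair, takeFn_boolPair, List.length_replicate]
  rw [blkFn, Function.comp_apply, fanoutFn_apply, fanoutFn_apply, mFn_zCode, Function.comp_apply, fstF_boolPair, cwF_yCode,
    blkAt_boolPair, fstF_boolPair, List.length_replicate, take_drop_clWordCode_pos hm]
  simp [clLetterCode]

/-- The target of the fold: the code of `(σⁱ w)⁻¹`, block by block. [folklore] -/
theorem take_drop_code_invRev {i j : ℕ} (hj : j < w.length) :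
    ((clWordCode r (FreeGroup.invRev (CBI.pos (w.rotate i)))).drop (j * (r + 1))).take (r + 1) =
      clLetterCode r (w[(w.length - 1 - j + i) % w.length]'(Nat.mod_lt _ (by omega)), false) := by
  have hlen : (FreeGroup.invRev (CBI.pos (w.rotate i))).length = w.length := by
    simp [FreeGroup.invRev, CBI.pos]
  rw [take_drop_clWordCode r _ j (by rw [hlen]; exact hj)]
  congr 1
  simp only [CBI.invRev_pos, CBI.neg, List.getElem_reverse, List.getElem_map, List.length_map, List.length_rotate,
    List.getElem_rotate]

/-- **Value of `nrFn`: the code of `(σⁱ w)⁻¹`.** [folklore] -/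
theorem nrFn_zCode (i : ℕ) : nrFn r (yCode v w k (ones i)) = clWordCode r (FreeGroup.invRev (CBI.pos (w.rotate i))) := by
  set z := yCode v w k (ones i) with hz
  have hinit : fanoutFn id (fanoutFn (lenBinF ∘ nF r) fun _ => boolPair [] []) z =
      boolPair z (boolPair (encodeNat w.length) (boolPair (ones 0) [])) := by
    simp [hz, ones]
  have hlen : w.length ≤ X.eval z.length := by
    rw [eval_X]
    have h1 := length_fstF_sndF_le z
    have h2 := length_fstF_sndF_le (fstF z)
    have h3 := length_fstF_sndF_le (fstF (fstF z))
    have h4 : (sndF (fstF (fstF z))).length = (r + 1) * w.length := by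
      rw [← length_clWordCode_pos, ← cwF_yCode v w k (ones i)]
      rfl
    nlinarith
  rw [nrFn, Function.comp_apply, Function.comp_apply, hinit, foldLoop_apply appF (gFn r) hlen 0 [],
    sndPow_succ_boolPair, sndPow_succ_boolPair, sndPow_zero_boolPair, foldAcc_appF, List.nil_append]
  have hW : (clWordCode r (FreeGroup.invRev (CBI.pos (w.rotate i)))).length = w.length * (r + 1) := by
    rw [length_clWordCode]
    simp [FreeGroup.invRev, CBI.pos, Nat.mul_comm]
  rw [← BitCodec.ccat_of_blocks hW]
  refine ccat_congr fun j hj => ?_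
  rw [Nat.zero_add, hz, gFn_zCode (by omega), take_drop_code_invRev hj]

/-- Word codes of concatenations. [folklore] -/
theorem clWordCode_append (a b : List (Fin r × Bool)) : clWordCode r (a ++ b) = clWordCode r a ++ clWordCode r b := by
  simp [clWordCode]

/-- **Value of the query generator on an instance code**: the CL-`F_r` instance code of
`(v · (σⁱ w)⁻¹, k)`. [cite: Heuer2020, Claim 3.11] -/
theorem qFn_zCode (i : ℕ) : qFn r (yCode v w k (ones i)) = clInstanceCode r (CBI.cword v (w.rotate i), k) := by
  rw [qFn, fanoutFn_apply, Function.comp_apply, fanoutFn_apply, cvF_yCode, nrFn_zCode, appF_boolPair, uF_yCode,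
    clInstanceCode, CBI.cword, clWordCode_append]
  simp [ones, OracleCompose.unaryEncodeNat_eq_replicate]

end Values

/-! ### The evaluator -/

/-- On `⟨x', 1ʲ⟩`: `[block j of fstF x' has a positive sign bit]`. [folklore] -/
def sgnC : List Bool → List Bool :=
  eqPairFn ∘ fanoutFn (dropFn ∘ fanoutFn (fun _ => ones r) (blkAt r)) fun _ => [true]
/-- On `x'`: `[every block of fstF x' is positive]`. [folklore] -/
def posT : List Bool → List Bool := allIdxFn (nU r) (sgnC r)

/-- `[y = ⟨fstF y, sndF y⟩]`. [folklore] -/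
def t1 : List Bool → List Bool := eqPairFn ∘ fanoutFn id (fanoutFn fstF sndF)
/-- `[x = ⟨x₁, U⟩]`. [folklore] -/
def t2 : List Bool → List Bool := eqPairFn ∘ fanoutFn fstF (fanoutFn (fstF ∘ fstF) (sndF ∘ fstF))
/-- `[x₁ = ⟨cv, cw⟩]`. [folklore] -/
def t3 : List Bool → List Bool := eqPairFn ∘ fanoutFn (fstF ∘ fstF) (fanoutFn cvF cwF)
/-- `[⟨cv, U⟩ is a CL instance code]`. [folklore] -/
def t4 : List Bool → List Bool := codeT r ∘ fanoutFn cvF uF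
/-- `[⟨cw, U⟩ is a CL instance code]`. [folklore] -/
def t5 : List Bool → List Bool := codeT r ∘ fanoutFn cwF uF
/-- `[cv is positive]`. [folklore] -/
def t6 : List Bool → List Bool := posT r ∘ fanoutFn cvF fun _ => []
/-- `[cw is positive]`. [folklore] -/
def t7 : List Bool → List Bool := posT r ∘ fanoutFn cwF fun _ => []
/-- `[|cv| = |cw|]`. [folklore] -/
def t8 : List Bool → List Bool := eqPairFn ∘ fanoutFn (onesFn ∘ cvF) (onesFn ∘ cwF)
/-- **The verdict** `[v = [] ∨ one of the first |v| answers is yes]`. [cite: Heuer2020, Claim 3.11] -/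
def t9 : List Bool → List Bool :=
  orFn (isNilFn ∘ cvF) ((TTClosure.hasBitT true).eval ∘ takeFn ∘ fanoutFn (nF r) sndF)
/-- **The evaluator's test.** [cite: Heuer2020, Thm. 2 (ii)] -/
def dT : List Bool → List Bool :=
  andFn t1 (andFn t2 (andFn t3 (andFn (t4 r) (andFn (t5 r) (andFn (t6 r) (andFn (t7 r) (andFn t8 (t9 r))))))))

/-- `sgnC ∈ FP`. [cite: AroraBarakCC2009, §1.3] -/
theorem sgnC_mem_FP : sgnC r ∈ FP :=
  comp_mem_FP eqPairFn_mem_FP (fanoutFn_mem_FP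
    (comp_mem_FP dropFn_mem_FP (fanoutFn_mem_FP (const_mem_FP _) (blkAt_mem_FP r))) (const_mem_FP _))
/-- `sgnC` is one-bit. [folklore] -/
theorem oneBit_sgnC : OneBit (sgnC r) := oneBit_eqPairFn.comp _
/-- `posT ∈ FP`. [cite: AroraBarakCC2009, §1.3] -/
theorem posT_mem_FP : posT r ∈ FP := allIdxFn_mem_FP (nU_mem_FP r) (sgnC_mem_FP r) (oneBit_sgnC r)
/-- `posT` is one-bit. [folklore] -/
theorem oneBit_posT : OneBit (posT r) := oneBit_allIdxFn (oneBit_sgnC r) (length_nU_le r)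

/-- The tests are in `FP`. [cite: AroraBarakCC2009, §1.3] -/
theorem t1_mem_FP : t1 ∈ FP := comp_mem_FP eqPairFn_mem_FP (fanoutFn_mem_FP id_mem_FP (fanoutFn_mem_FP fstF_mem_FP sndF_mem_FP))
/-- The tests are in `FP`. [cite: AroraBarakCC2009, §1.3] -/
theorem t2_mem_FP : t2 ∈ FP :=
  comp_mem_FP eqPairFn_mem_FP (fanoutFn_mem_FP fstF_mem_FP
    (fanoutFn_mem_FP (comp_mem_FP fstF_mem_FP fstF_mem_FP) (comp_mem_FP sndF_mem_FP fstF_mem_FP)))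
/-- The tests are in `FP`. [cite: AroraBarakCC2009, §1.3] -/
theorem t3_mem_FP : t3 ∈ FP :=
  comp_mem_FP eqPairFn_mem_FP (fanoutFn_mem_FP (comp_mem_FP fstF_mem_FP fstF_mem_FP) (fanoutFn_mem_FP cvF_mem_FP cwF_mem_FP))
/-- The tests are in `FP`. [cite: AroraBarakCC2009, §1.3] -/
theorem t4_mem_FP : t4 r ∈ FP := comp_mem_FP (codeT_mem_FP r) (fanoutFn_mem_FP cvF_mem_FP uF_mem_FP)
/-- The tests are in `FP`. [cite: AroraBarakCC2009, §1.3] -/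
theorem t5_mem_FP : t5 r ∈ FP := comp_mem_FP (codeT_mem_FP r) (fanoutFn_mem_FP cwF_mem_FP uF_mem_FP)
/-- The tests are in `FP`. [cite: AroraBarakCC2009, §1.3] -/
theorem t6_mem_FP : t6 r ∈ FP := comp_mem_FP (posT_mem_FP r) (fanoutFn_mem_FP cvF_mem_FP (const_mem_FP _))
/-- The tests are in `FP`. [cite: AroraBarakCC2009, §1.3] -/
theorem t7_mem_FP : t7 r ∈ FP := comp_mem_FP (posT_mem_FP r) (fanoutFn_mem_FP cwF_mem_FP (const_mem_FP _))
/-- The tests are in `FP`. [cite: AroraBarakCC2009, §1.3] -/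
theorem t8_mem_FP : t8 ∈ FP :=
  comp_mem_FP eqPairFn_mem_FP (fanoutFn_mem_FP (comp_mem_FP onesFn_mem_FP cvF_mem_FP) (comp_mem_FP onesFn_mem_FP cwF_mem_FP))
/-- The tests are in `FP`. [cite: AroraBarakCC2009, §1.3] -/
theorem t9_mem_FP : t9 r ∈ FP :=
  orFn_mem_FP (comp_mem_FP isNilFn_mem_FP cvF_mem_FP)
    (comp_mem_FP (TTClosure.hasBitT true).polyTimeComputable_eval (comp_mem_FP takeFn_mem_FP
      (fanoutFn_mem_FP (nF_mem_FP r) sndF_mem_FP)))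

/-- The tests are one-bit. [folklore] -/
theorem oneBit_t1 : OneBit t1 := oneBit_eqPairFn.comp _
/-- The tests are one-bit. [folklore] -/
theorem oneBit_t2 : OneBit t2 := oneBit_eqPairFn.comp _
/-- The tests are one-bit. [folklore] -/
theorem oneBit_t3 : OneBit t3 := oneBit_eqPairFn.comp _
/-- The tests are one-bit. [folklore] -/
theorem oneBit_t4 : OneBit (t4 r) := (oneBit_codeT r).comp _
/-- The tests are one-bit. [folklore] -/
theorem oneBit_t5 : OneBit (t5 r) := (oneBit_codeT r).comp _
/-- The tests are one-bit. [folklore] -/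
theorem oneBit_t6 : OneBit (t6 r) := (oneBit_posT r).comp _
/-- The tests are one-bit. [folklore] -/
theorem oneBit_t7 : OneBit (t7 r) := (oneBit_posT r).comp _
/-- The tests are one-bit. [folklore] -/
theorem oneBit_t8 : OneBit t8 := oneBit_eqPairFn.comp _
/-- The hasBit transducer is one-bit. [folklore] -/
theorem oneBit_hasBit : OneBit ((TTClosure.hasBitT true).eval ∘ takeFn ∘ fanoutFn (nF r) sndF) := fun z =>
  ⟨_, by rw [Function.comp_apply, TTClosure.hasBitT_eval]⟩
/-- The tests are one-bit. [folklore] -/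
theorem oneBit_t9 : OneBit (t9 r) := (oneBit_isNilFn.comp _).ite (fun _ => ⟨true, rfl⟩) (oneBit_hasBit r)

/-- **`dT ∈ FP`.** [cite: AroraBarakCC2009, §1.3] -/
theorem dT_mem_FP : dT r ∈ FP :=
  andFn_mem_FP t1_mem_FP (andFn_mem_FP t2_mem_FP (andFn_mem_FP t3_mem_FP (andFn_mem_FP (t4_mem_FP r)
    (andFn_mem_FP (t5_mem_FP r) (andFn_mem_FP (t6_mem_FP r) (andFn_mem_FP (t7_mem_FP r)
      (andFn_mem_FP t8_mem_FP (t9_mem_FP r))))))))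

/-- `dT` is one-bit. [folklore] -/
theorem oneBit_dT : OneBit (dT r) :=
  oneBit_andFn oneBit_t1 (oneBit_andFn oneBit_t2 (oneBit_andFn oneBit_t3 (oneBit_andFn (oneBit_t4 r)
    (oneBit_andFn (oneBit_t5 r) (oneBit_andFn (oneBit_t6 r) (oneBit_andFn (oneBit_t7 r)
      (oneBit_andFn oneBit_t8 (oneBit_t9 r))))))))

/-- **The evaluator language** `dLang r = {y | dT y = 1}`. [cite: Heuer2020, Thm. 2 (ii)] -/
def dLang : Language Bool := {y | dT r y = [true]}

/-- `dLang ∈ P`. [cite: AroraBarakCC2009, §1.3] -/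
theorem dLang_mem_P : dLang r ∈ Classes.P := CliqueNP.mem_P_of_oneBit (dT_mem_FP r) (oneBit_dT r)

/-! ### Truth of the evaluator -/

section Truth

variable {r}

/-- A word all of whose letters are positive is `pos` of its generator sequence. [folklore] -/
theorem eq_pos_of_forall_snd {L : List (Fin r × Bool)} (h : ∀ x ∈ L, x.2 = true) : L = CBI.pos (L.map Prod.fst) := by
  rw [CBI.pos, List.map_map]
  conv_lhs => rw [← List.map_id L]
  exact List.map_congr_left fun x hx => Prod.ext rfl (by simpa using h x hx)

/-- Letters of a positive word are positive. [folklore] -/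
theorem snd_of_mem_pos {v : List (Fin r)} {x : Fin r × Bool} (hx : x ∈ CBI.pos v) : x.2 = true := by
  simp only [CBI.pos, List.mem_map] at hx
  obtain ⟨a, -, rfl⟩ := hx
  rfl

/-- Value of the sign test on block `j` of a word code. [folklore] -/
theorem sgnC_code (L : List (Fin r × Bool)) {j : ℕ} (hj : j < L.length) :
    sgnC r (boolPair (boolPair (clWordCode r L) []) (ones j)) = [decide ((L[j]).2 = true)] := by
  rw [sgnC, Function.comp_apply, fanoutFn_apply, Function.comp_apply, fanoutFn_apply, blkAt_boolPair, fstF_boolPair,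
    List.length_replicate, take_drop_clWordCode r L j hj, dropFn_boolPair, List.length_replicate, eqPairFn_boolPair]
  have : (clLetterCode r L[j]).drop r = [(L[j]).2] := by
    rw [clLetterCode, List.drop_append_of_le_length (by simp), List.drop_of_length_le (by simp), List.nil_append]
  rw [this]
  by_cases h : (L[j]).2 = true <;> simp [h]

/-- **Truth of the positivity test** on a word code. [folklore] -/
theorem posT_code_iff (L : List (Fin r × Bool)) :
    posT r (boolPair (clWordCode r L) []) = [true] ↔ ∀ x ∈ L, x.2 = true := by
  rw [posT, allIdxFn_apply (oneBit_sgnC r) (length_nU_le r _), nU_apply, fstF_boolPair, length_clWordCode,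
    Nat.mul_div_cancel_left _ (Nat.succ_pos r), List.length_replicate, HamNP.singleton_decide_eq_true_iff]
  constructor
  · intro h x hx
    obtain ⟨j, hj, rfl⟩ := List.getElem_of_mem hx
    have := h j hj
    rwa [sgnC_code L hj, HamNP.singleton_decide_eq_true_iff] at this
  · intro h j hj
    rw [sgnC_code L hj, HamNP.singleton_decide_eq_true_iff]
    exact h _ (List.getElem_mem hj)

/-- The instance code unfolded. [folklore] -/
theorem yCode_eq (v w : List (Fin r)) (k : ℕ) (b : List Bool) :
    yCode v w k b = boolPair (boolPair (boolPair (clWordCode r (CBI.pos v)) (clWordCode r (CBI.pos w))) (ones k)) b := by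
  simp [yCode, cbiInstanceCode, OracleCompose.unaryEncodeNat_eq_replicate]

/-- **Truth of the evaluator**: `dT y = 1` iff `y = ⟨code((v,w),k), b⟩` for positive words of equal
length with `v = []` or a yes among the first `|v|` answer bits `b`. [cite: Heuer2020, Thm. 2 (ii)] -/
theorem dT_true_iff (y : List Bool) :
    dT r y = [true] ↔ ∃ (v w : List (Fin r)) (k : ℕ) (b : List Bool), w.length = v.length ∧
      y = yCode v w k b ∧ (v = [] ∨ true ∈ b.take v.length) := by
  rw [dT, andFn_eq_true_iff oneBit_t1 (oneBit_andFn oneBit_t2 (oneBit_andFn oneBit_t3 (oneBit_andFn (oneBit_t4 r)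
      (oneBit_andFn (oneBit_t5 r) (oneBit_andFn (oneBit_t6 r) (oneBit_andFn (oneBit_t7 r)
        (oneBit_andFn oneBit_t8 (oneBit_t9 r)))))))),
    andFn_eq_true_iff oneBit_t2 (oneBit_andFn oneBit_t3 (oneBit_andFn (oneBit_t4 r)
      (oneBit_andFn (oneBit_t5 r) (oneBit_andFn (oneBit_t6 r) (oneBit_andFn (oneBit_t7 r)
        (oneBit_andFn oneBit_t8 (oneBit_t9 r))))))),
    andFn_eq_true_iff oneBit_t3 (oneBit_andFn (oneBit_t4 r)
      (oneBit_andFn (oneBit_t5 r) (oneBit_andFn (oneBit_t6 r) (oneBit_andFn (oneBit_t7 r)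
        (oneBit_andFn oneBit_t8 (oneBit_t9 r)))))),
    andFn_eq_true_iff (oneBit_t4 r)
      (oneBit_andFn (oneBit_t5 r) (oneBit_andFn (oneBit_t6 r) (oneBit_andFn (oneBit_t7 r)
        (oneBit_andFn oneBit_t8 (oneBit_t9 r))))),
    andFn_eq_true_iff (oneBit_t5 r) (oneBit_andFn (oneBit_t6 r) (oneBit_andFn (oneBit_t7 r)
        (oneBit_andFn oneBit_t8 (oneBit_t9 r)))),
    andFn_eq_true_iff (oneBit_t6 r) (oneBit_andFn (oneBit_t7 r) (oneBit_andFn oneBit_t8 (oneBit_t9 r))),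
    andFn_eq_true_iff (oneBit_t7 r) (oneBit_andFn oneBit_t8 (oneBit_t9 r)),
    andFn_eq_true_iff oneBit_t8 (oneBit_t9 r)]
  have e1 : t1 y = [true] ↔ y = boolPair (fstF y) (sndF y) := by
    rw [t1, Function.comp_apply, fanoutFn_apply, fanoutFn_apply, eqPairFn_boolPair_eq_true]; rfl
  have e2 : t2 y = [true] ↔ fstF y = boolPair (fstF (fstF y)) (sndF (fstF y)) := by
    rw [t2, Function.comp_apply, fanoutFn_apply, fanoutFn_apply, eqPairFn_boolPair_eq_true]; rfl
  have e3 : t3 y = [true] ↔ fstF (fstF y) = boolPair (cvF y) (cwF y) := by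
    rw [t3, Function.comp_apply, fanoutFn_apply, fanoutFn_apply, eqPairFn_boolPair_eq_true]; rfl
  have e4 : t4 r y = [true] ↔ ∃ (L : List (Fin r × Bool)) (k : ℕ), boolPair (cvF y) (uF y) = clInstanceCode r (L, k) := by
    rw [t4, Function.comp_apply, fanoutFn_apply, codeT_true_iff]
  have e5 : t5 r y = [true] ↔ ∃ (L : List (Fin r × Bool)) (k : ℕ), boolPair (cwF y) (uF y) = clInstanceCode r (L, k) := by
    rw [t5, Function.comp_apply, fanoutFn_apply, codeT_true_iff]
  have e6 : t6 r y = posT r (boolPair (cvF y) []) := by rw [t6, Function.comp_apply, fanoutFn_apply]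
  have e7 : t7 r y = posT r (boolPair (cwF y) []) := by rw [t7, Function.comp_apply, fanoutFn_apply]
  have e8 : t8 y = [true] ↔ (cvF y).length = (cwF y).length := by
    rw [t8, Function.comp_apply, fanoutFn_apply, eqPairFn_boolPair_eq_true, Function.comp_apply, Function.comp_apply,
      CLNP.onesFn_eq, CLNP.onesFn_eq]
    exact ⟨fun h => by simpa using congrArg List.length h, fun h => by rw [h]⟩
  have e9 : t9 r y = [true] ↔ cvF y = [] ∨ true ∈ (sndF y).take (nF r y).length := by
    rw [t9, orFn_eq_true_iff (oneBit_isNilFn.comp _) (oneBit_hasBit r), Function.comp_apply, isNilFn_eq_true_iff,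
      Function.comp_apply, Function.comp_apply, fanoutFn_apply, takeFn_boolPair, TTClosure.hasBitT_eval,
      HamNP.singleton_decide_eq_true_iff]
  rw [e1, e2, e3, e4, e5, e6, e7, e8, e9]
  constructor
  · rintro ⟨h1, h2, h3, ⟨L₁, k₁, h4⟩, ⟨L₂, k₂, h5⟩, h6, h7, h8, h9⟩
    have h4' := boolPair_injective (a₁ := (cvF y, uF y)) (a₂ := (clWordCode r L₁, unaryEncodeNat k₁)) h4
    have h5' := boolPair_injective (a₁ := (cwF y, uF y)) (a₂ := (clWordCode r L₂, unaryEncodeNat k₂)) h5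
    simp only [Prod.mk.injEq] at h4' h5'
    obtain ⟨hcv, hu⟩ := h4'
    obtain ⟨hcw, -⟩ := h5'
    rw [hcv, posT_code_iff] at h6
    rw [hcw, posT_code_iff] at h7
    have hL₁ := eq_pos_of_forall_snd h6
    have hL₂ := eq_pos_of_forall_snd h7
    set v := L₁.map Prod.fst
    set w := L₂.map Prod.fst
    have hlen : w.length = v.length := by
      rw [hcv, hcw, hL₁, hL₂, length_clWordCode_pos, length_clWordCode_pos] at h8
      exact (Nat.eq_of_mul_eq_mul_left (Nat.succ_pos r) h8).symm
    refine ⟨v, w, k₁, sndF y, hlen, ?_, ?_⟩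
    · rw [yCode_eq, ← hL₁, ← hL₂, ← hcv, ← hcw,
        show ones k₁ = uF y from (OracleCompose.unaryEncodeNat_eq_replicate k₁).symm.trans hu.symm,
        show uF y = sndF (fstF y) from rfl, ← h3, ← h2]
      exact h1
    · rcases h9 with h9 | h9
      · left
        rw [hcv, hL₁] at h9
        have := congrArg List.length h9
        rw [length_clWordCode_pos] at this
        exact List.eq_nil_of_length_eq_zero (by simpa using this)
      · right
        have hn : (nF r y).length = v.length := by
          rw [nF, Function.comp_apply, fanoutFn_apply, nU_apply, fstF_boolPair, hcw, hL₂, length_clWordCode_pos,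
            Nat.mul_div_cancel_left _ (Nat.succ_pos r), List.length_replicate, hlen]
        rwa [hn] at h9
  · rintro ⟨v, w, k, b, hlen, rfl, hv⟩
    refine ⟨?_, ?_, ?_, ⟨CBI.pos v, k, ?_⟩, ⟨CBI.pos w, k, ?_⟩, ?_, ?_, ?_, ?_⟩
    · rw [yCode, fstF_boolPair, sndF_boolPair]
    · rw [yCode_eq]; simp
    · rw [yCode_eq]; simp [cvF, cwF]
    · rw [cvF_yCode, uF_yCode]; simp [clInstanceCode, OracleCompose.unaryEncodeNat_eq_replicate]
    · rw [cwF_yCode, uF_yCode]; simp [clInstanceCode, OracleCompose.unaryEncodeNat_eq_replicate]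
    · rw [cvF_yCode, posT_code_iff]; exact fun x hx => snd_of_mem_pos hx
    · rw [cwF_yCode, posT_code_iff]; exact fun x hx => snd_of_mem_pos hx
    · rw [cvF_yCode, cwF_yCode, length_clWordCode_pos, length_clWordCode_pos, hlen]
    · rw [cvF_yCode, sndF_yCode, nF_yCode, List.length_replicate, hlen]
      rcases hv with rfl | hv
      · exact Or.inl rfl
      · exact Or.inr hv

/-- Membership in the evaluator language. [cite: Heuer2020, Thm. 2 (ii)] -/
theorem mem_dLang_iff (y : List Bool) :
    y ∈ dLang r ↔ ∃ (v w : List (Fin r)) (k : ℕ) (b : List Bool), w.length = v.length ∧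
      y = yCode v w k b ∧ (v = [] ∨ true ∈ b.take v.length) :=
  dT_true_iff y

end Truth

end CBIRed

/-! ### CBI-`F_r ≤ᵀₚ` CL-`F_r` -/

section Assembly

open CBIRed

variable (r : ℕ)

/-- An instance code is at least as long as its number of letters. [folklore] -/
theorem length_le_cbiInstanceCode (v w : List (Fin r)) (k : ℕ) : v.length ≤ (cbiInstanceCode r ((v, w), k)).length := by
  have h1 := length_fstF_sndF_le (cbiInstanceCode r ((v, w), k))
  have h2 := length_fstF_sndF_le (fstF (cbiInstanceCode r ((v, w), k)))
  have h3 : (fstF (fstF (cbiInstanceCode r ((v, w), k)))).length = (r + 1) * v.length := by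
    rw [← length_clWordCode_pos, ← cvF_yCode v w k []]
    simp [cvF, yCode]
  nlinarith

/-- A positive answer to query `i` means: `v` and `σⁱ w` are related and `cl(v · (σⁱ w)⁻¹) ≤ k`. [cite: Heuer2020, §3.3] -/
theorem qFn_mem_clLanguage_iff (v w : List (Fin r)) (k i : ℕ) :
    qFn r (yCode v w k (ones i)) ∈ clLanguage r ↔
      List.Perm v (w.rotate i) ∧ commutatorLength (FreeGroup.mk (CBI.cword v (w.rotate i))) ≤ k := by
  rw [qFn_zCode, clInstanceCode_mem_clLanguage_iff, mem_clDecisionSet_iff, CBI.mk_cword_mem_commutator_iff]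

/-- **CBI-`F_r` is the truth-table reduction of `dLang` to CL-`F_r` by the queries `qFn`** (one per
rotation of `w`; [Heuer2020, Thm. 2 (i) and Claim 3.11] supply correctness, and the
commutator-subgroup criterion rejects unrelated instances). [cite: Heuer2020, Thm. 2] -/
theorem cbiLanguage_eq_ttLang : cbiLanguage r = ttLang (qFn r) X (dLang r) (clLanguage r) := by
  ext x
  rw [mem_ttLang_iff, mem_dLang_iff, eval_X]
  constructor
  · rintro ⟨⟨⟨v, w⟩, k⟩, ⟨hperm, hd⟩, rfl⟩
    dsimp only at hperm hd
    refine ⟨v, w, k, _, hperm.length_eq.symm, rfl, ?_⟩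
    by_cases hv : v = []
    · exact Or.inl hv
    · right
      obtain ⟨i, hi, hcl⟩ := (CBI.dcbi_le_iff_exists_commutatorLength_rotate_le hperm hv k).1 hd
      have hlen : v.length ≤ (cbiInstanceCode r ((v, w), k)).length := length_le_cbiInstanceCode r v w k
      rw [List.mem_iff_getElem]
      refine ⟨i, by rw [List.length_take, length_ttBits]; omega, ?_⟩
      rw [List.getElem_take, getElem_ttBits_eq_true_iff]
      change qFn r (yCode v w k (ones i)) ∈ clLanguage r
      rw [qFn_mem_clLanguage_iff]
      exact ⟨hperm.trans (List.rotate_perm w i).symm, hcl⟩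
  · rintro ⟨v, w, k, b, hlen, hy, hv⟩
    have hy' := boolPair_injective (a₁ := (x, _)) (a₂ := (cbiInstanceCode r ((v, w), k), b)) hy
    simp only [Prod.mk.injEq] at hy'
    obtain ⟨rfl, hb⟩ := hy'
    refine ⟨((v, w), k), ?_, rfl⟩
    rcases hv with rfl | hv
    · obtain rfl : w = [] := List.eq_nil_of_length_eq_zero hlen
      exact ⟨List.Perm.refl _, by rw [(CBI.dcbi_eq_zero_iff (List.Perm.refl _)).2 (List.IsRotated.refl _)]; exact Nat.zero_le _⟩
    · rw [List.mem_iff_getElem] at hv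
      obtain ⟨i, hi, hbi⟩ := hv
      rw [List.length_take] at hi
      have hin : i < v.length := lt_of_lt_of_le hi (min_le_left _ _)
      have hib : i < b.length := lt_of_lt_of_le hi (min_le_right _ _)
      rw [List.getElem_take] at hbi
      have hb2 : ttBits (qFn r) (clLanguage r) (cbiInstanceCode r ((v, w), k)) (cbiInstanceCode r ((v, w), k)).length = b := hb
      have h3 : (ttBits (qFn r) (clLanguage r) (cbiInstanceCode r ((v, w), k)) (cbiInstanceCode r ((v, w), k)).length)[i]'(by
          rw [hb2]; exact hib) = true := (List.getElem_of_eq hb2 _).trans hbi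
      rw [getElem_ttBits_eq_true_iff] at h3
      change qFn r (yCode v w k (ones i)) ∈ clLanguage r at h3
      rw [qFn_mem_clLanguage_iff] at h3
      have hperm : List.Perm v w := h3.1.trans (List.rotate_perm w i)
      have hne : v ≠ [] := List.ne_nil_of_length_pos (by omega)
      exact ⟨hperm, (CBI.dcbi_le_iff_exists_commutatorLength_rotate_le hperm hne k).2 ⟨i, hin, h3.2⟩⟩

/-- **CBI-`F_r ∈ P^{CL-F_r}`**: the cyclic block interchange problem is decided in polynomial time
with an oracle for commutator length in `F_r` ([Heuer2020, Thm. 2 (ii)]: "there is a polynomial time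
reduction from CBI-`A` to CL-`F(A)`" — `|w|` oracle calls, Claim 3.11). [cite: Heuer2020, Thm. 2 (ii)] -/
theorem cbiLanguage_mem_PRel : cbiLanguage r ∈ PRel (Oracle.ofLanguage (clLanguage r)) := by
  rw [cbiLanguage_eq_ttLang]
  exact ttLang_mem_PRel (qFn_mem_FP r) (dLang_mem_P r) _

/-- **CBI-`F_r ≤ᵀₚ` CL-`F_r`.** [cite: Heuer2020, Thm. 2 (ii)] -/
theorem cbiLanguage_turingReducible : PolyTimeTuringReducible (cbiLanguage r) (clLanguage r) :=
  cbiLanguage_mem_PRel r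

end Assembly

/-- **What the named fact now needs**: if CBI-`F₂` is NP-hard (Karp) — the binary case of
[Heuer2020, Thm. 3], whose printed proof goes through the strong NP-completeness of 3-PARTITION
and Lemma 4.6 — then `Heuer2020_clNPComplete` holds: every `NP` language Karp-reduces to CBI-`F₂`,
which Turing-reduces to CL-`F₂` (`cbiLanguage_turingReducible`), and the rank climbs
(`Heuer2020_clNPComplete_iff_two`). [cite: Heuer2020, Thm. 1 and §5] -/
theorem Heuer2020_clNPComplete_of_cbi_isNPHard (h : IsNPHard (cbiLanguage 2)) : Heuer2020_clNPComplete :=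
  Heuer2020_clNPComplete_iff_two.2 fun L hL =>
    polyTimeTuringReducible_trans_holds (PolyTimeKarpReducible.turing_holds (h L hL)) (cbiLanguage_turingReducible 2)


end Literature.GroupTheory.CombinatorialGroupTheory

end
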